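import Summits.ResolutionOfSingularities.ResolutionOfSingularities.Theorems.PurelyInseparableDim4ResConeBInfFrames
import Summits.ResolutionOfSingularities.ResolutionOfSingularities.Theorems.PurelyInseparableDim4ResConeWeightsPresentation
import Summits.ResolutionOfSingularities.ResolutionOfSingularities.Theorems.PurelyInseparableDim4PhiLineLinearLabel
import Summits.ResolutionOfSingularities.ResolutionOfSingularities.Theorems.PurelyInseparableDim4PhiLineDeltaLabel
import Summits.ResolutionOfSingularities.ResolutionOfSingularities.Theorems.PurelyInseparableDim4ResConeCornerWalls
import HarnessLib
import HarnessLib.Audit.Tags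

/-!
# Purely inseparable four-folds — STUB E of the B∞ assembly at `(p, d) = (5, 3)`: the ENTRY FRAME at a Q-state
# (K2(p) lane, slice C `(5,3)`, memo §17 (R4); cell `res-dim4-pi`)

[OURS · counted 0 · cell `res-dim4-pi` · K2(p) lane holder res-dim4-p-12 g4's skeleton v2 `BInf-ASSEMBLY-SKELETON.lean`
(b10e0a76a4b9b1eb), stub **E** `stub_entryFrame` «p-9 takes STUB E» (bus 2026-08-29 06:02Z); the Φ-line letters res-dim4-p-11 g4
((K-Φ1) `PhiLine.alphaS_lt_of_isIsolated`, (K-Φ2) III `…PhiLineLinearFrame`, (K-Φ3) IV/VI `…PhiLineDeltaLabel` /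
`…PhiLineLinearLabel`) and res-dim4-idea-1 g7 (residue list R1–R5); the weights res-dim4-p-12 g4 (W `…ResConeThreeWeights`);
seat res-dim4-p-9 g4.]  Nothing here proves K2(p)/K2(5), `NoIsolatedTrap p p`, the β_h line, or resolution of singularities in
dimension ≥ 4 / characteristic `p`.  AI kernel work, weaker than expert review.

THE STUB (with the skeleton's `EntryInv` / `frameOf` / `resIdeal` UNFOLDED): on TAIL-B data (isolated witnessed `Step0 5` chain,
`x^{r₀} ∣ F₀`, off the floor, shade `3` and `e_G = 2` from `k₀`), at a Q-state `k ≥ k₀` (`|r_k| = 4`, heavy letter `W`,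
`r_k W = 2`) there is a linear frame `L : Fin (2+2) → Fin 4 → K` with left inverse `M` such that `L u₁ = e_W`, the two y-rows
annihilate `resVertex (c k)`, and the polygon of `(G_k)`, `G_k = F_k / x^{r_k}`, in the frame `(Σ_t L_{i t} x_t / 1)_i` of
`𝒪 = K[x]_{(x)}` is a LABEL polygon: `pts ≠ ∅`, `3! < δs`, `αs < 3!`.
* §1 the DUAL BASIS (`exists_dualColumns`): since the Q-step HITS `W` (W's `bInf_pattern`) the step direction `w ∈ resVertex`
  (`chain_direction_mem_resVertex`) has `w_W ≠ 0`; with `e_G = 2` this yields `m₃, m₄ ∈ resVertex` with `(W, m)`-coordinates `(1,0)`,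
  `(0,1)` for a second letter `m`; columns `(e_a, e_{a′}, m₃, m₄)` and rows `(e_a − (m₃)_a e_W − (m₄)_a e_m, e_{a′} − …, e_W, e_m)`
  are inverse to each other EXPLICITLY (`entryRows_mul`) — no matrix inversion;
* §2 the LABEL (`label_of_dual_columns`, `residual_mem_label`): a cubic form whose polar kernel contains the two `u`-columns of the
  dual basis lies in `(ℓ_{y₁}, ℓ_{y₂})³` (translation invariance along `A(g)`, `PhiLine.aeval_add_sum_mul_eq_aeval`, degree
  `3 < 5`), hence `G_k ∈ (ℓ_y)³ ⊔ 𝔪₀⁴`;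
* §3 **`stub_entryFrame`** — the stub: `alphaS_lt_of_isIsolated` (`u₁ = x_W`, `r_W + 3 = 5`) and
  `factorial_lt_deltaS_span_singleton_iff` + `span_singleton_algebraMap_le_yIdeal_pow_sup` over §§1–2.
[cite: CossartJannsenSaito2020, Def. 8.2, Def. 8.4, Lemma 12.2 (2)] [cite: CossartPiltant2008, §4 p. 11]
[cite: Hironaka1970AdditiveGroups, §1]
bears_on: LADDER-RESOLUTION:D157-DOOR2 (res-dim4-pi · K2(p) · slice C (5,3) B∞ assembly, stub E).  Supports
stmt-ResolutionOfSingularities-16155 (helper).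
-/

set_option linter.dupNamespace false -- mandated namespace of this single-conjunct summit

noncomputable section

namespace Summit.ResolutionOfSingularities.ResolutionOfSingularities.Theorems.PIDim4

namespace ResCone

open MvPolynomial Finset IsLocalRing
open Literature.AlgebraicGeometry.Resolution
open Literature.AlgebraicGeometry.Resolution.CentreBlowup
open Literature.AlgebraicGeometry.Resolution.Hauser2010
open Literature.AlgebraicGeometry.Resolution.HauserPerlega2019
open Literature.AlgebraicGeometry.Resolution.WeightedOrder
open PointBlowup (additiveSubspace direction)

variable {K : Type} [Field K]

/-! ## 0. Index bookkeeping on `Fin (2+2)` -/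

/-- The four frame indices: `y₁ = 0`, `y₂ = 1`, `u₁ = u1 2 = 2`, `u₂ = u2 2 = 3`. [folklore] -/
theorem frameIndex_cases (i : Fin (2 + 2)) : i = 0 ∨ i = 1 ∨ i = u1 2 ∨ i = u2 2 := by
  revert i; decide

/-- Sums over the four frame indices. [folklore] -/
theorem sum_frameIndex {A : Type*} [AddCommMonoid A] (f : Fin (2 + 2) → A) :
    ∑ i, f i = f 0 + f 1 + f (u1 2) + f (u2 2) := by
  rw [Fin.sum_univ_four]; rfl

/-- The y-indices are not the u-indices. [folklore] -/
theorem frameIndex_ne : (0 : Fin (2 + 2)) ≠ u1 2 ∧ (0 : Fin (2 + 2)) ≠ u2 2 ∧ (1 : Fin (2 + 2)) ≠ u1 2 ∧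
    (1 : Fin (2 + 2)) ≠ u2 2 ∧ (0 : Fin (2 + 2)) ≠ 1 ∧ (u1 2 : Fin (2 + 2)) ≠ u2 2 := by
  decide

/-! ## 1. The dual basis attached to a transversal plane -/

section Dual

/-- **Two more letters.**  Given `W ≠ m` there are `a, a′` with `{W, m, a, a′}` = all four letters. [folklore] -/
theorem exists_two_other_letters {W m : Fin 4} (hWm : W ≠ m) :
    ∃ a a' : Fin 4, a ≠ W ∧ a ≠ m ∧ a' ≠ W ∧ a' ≠ m ∧ a ≠ a' ∧ ∀ i : Fin 4, i = W ∨ i = m ∨ i = a ∨ i = a' := by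
  classical
  have hcard : (({W, m} : Finset (Fin 4))ᶜ).card = 2 := by
    rw [Finset.card_compl, Fintype.card_fin, Finset.card_pair hWm]
  obtain ⟨a, ha⟩ : (({W, m} : Finset (Fin 4))ᶜ).Nonempty := by
    rw [← Finset.card_pos, hcard]; norm_num
  rw [Finset.mem_compl, Finset.mem_insert, Finset.mem_singleton, not_or] at ha
  obtain ⟨a', ha'W, ha'm, ha'a, hall⟩ := exists_fourth_letter hWm (Ne.symm ha.1) (Ne.symm ha.2)
  exact ⟨a, a', ha.1, ha.2, ha'W, ha'm, Ne.symm ha'a, hall⟩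

/-- **A vector of the plane inside the hyperplane `{w_W = 0}`.**  A `2`-dimensional subspace `V ⊆ K⁴` contains a NON-ZERO vector
with vanishing `W`-coordinate. [folklore] -/
theorem exists_mem_apply_eq_zero {V : Submodule K (Fin 4 → K)} (hV : Module.finrank K V = 2) (W : Fin 4) :
    ∃ v ∈ V, v W = 0 ∧ v ≠ 0 := by
  by_contra hno
  push Not at hno
  -- the coordinate `W` is injective on `V`, so `finrank V ≤ 1`
  set f : V →ₗ[K] K := (LinearMap.proj W).comp V.subtype with hf
  have hinj : Function.Injective f := by
    rw [← LinearMap.ker_eq_bot, LinearMap.ker_eq_bot']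
    intro v hv
    have h0 : (v : Fin 4 → K) W = 0 := hv
    have := hno v v.2 h0
    exact Subtype.ext this
  have hle := LinearMap.finrank_le_finrank_of_injective hinj
  rw [hV, Module.finrank_self] at hle
  omega

/-- **THE DUAL COLUMNS.**  If `V ⊆ K⁴` is `2`-dimensional and contains a vector `w` with `w_W ≠ 0`, then there are a letter
`m ≠ W` and vectors `m₃, m₄ ∈ V` with `(m₃)_W = 1, (m₃)_m = 0, (m₄)_W = 0, (m₄)_m = 1` (the projection of `V` onto the
`(W, m)`-coordinates is an isomorphism). [OURS · linear algebra] [cite: CossartJannsenSaito2020, Def. 8.2] -/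
theorem exists_dualColumns {V : Submodule K (Fin 4 → K)} (hV : Module.finrank K V = 2) {W : Fin 4} {w : Fin 4 → K}
    (hw : w ∈ V) (hwW : w W ≠ 0) :
    ∃ (m : Fin 4) (m₃ m₄ : Fin 4 → K), m ≠ W ∧ m₃ ∈ V ∧ m₄ ∈ V ∧ m₃ W = 1 ∧ m₃ m = 0 ∧ m₄ W = 0 ∧ m₄ m = 1 := by
  obtain ⟨v, hvV, hvW, hv0⟩ := exists_mem_apply_eq_zero hV W
  obtain ⟨m, hvm⟩ : ∃ m, v m ≠ 0 := by
    by_contra h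
    push Not at h
    exact hv0 (funext h)
  have hmW : m ≠ W := fun h => hvm (h ▸ hvW)
  set m₄ : Fin 4 → K := (v m)⁻¹ • v with hm₄
  have hm₄W : m₄ W = 0 := by rw [hm₄, Pi.smul_apply, hvW, smul_zero]
  have hm₄m : m₄ m = 1 := by rw [hm₄, Pi.smul_apply, smul_eq_mul, inv_mul_cancel₀ hvm]
  have hm₄V : m₄ ∈ V := V.smul_mem _ hvV
  set m₃ : Fin 4 → K := (w W)⁻¹ • w - ((w W)⁻¹ * w m) • m₄ with hm₃
  refine ⟨m, m₃, m₄, hmW, ?_, hm₄V, ?_, ?_, hm₄W, hm₄m⟩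
  · exact V.sub_mem (V.smul_mem _ hw) (V.smul_mem _ hm₄V)
  · rw [hm₃, Pi.sub_apply, Pi.smul_apply, Pi.smul_apply, hm₄W, smul_eq_mul, smul_zero, sub_zero, inv_mul_cancel₀ hwW]
  · rw [hm₃, Pi.sub_apply, Pi.smul_apply, Pi.smul_apply, hm₄m, smul_eq_mul, smul_eq_mul, mul_one, sub_self]

/-- **THE ENTRY ROWS TIMES THE DUAL COLUMNS = 1.**  For four letters `{a, a′, W, m}` and vectors `m₃, m₄` with
`(m₃)_W = 1, (m₃)_m = 0, (m₄)_W = 0, (m₄)_m = 1`, the rows `y₁ = e_a − (m₃)_a e_W − (m₄)_a e_m`,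
`y₂ = e_{a′} − (m₃)_{a′} e_W − (m₄)_{a′} e_m`, `u₁ = e_W`, `u₂ = e_m` and the columns `(e_a, e_{a′}, m₃, m₄)` satisfy
`Σ_i col_i(t) · row_i(u) = δ_{t u}` — the `hM` binder of the Φ-line frames, explicitly. [OURS · linear algebra]
[cite: CossartJannsenSaito2020, Def. 8.2] -/
theorem entryRows_mul {a a' W m : Fin 4} (haW : a ≠ W) (ham : a ≠ m) (ha'W : a' ≠ W) (ha'm : a' ≠ m) (haa' : a ≠ a')
    (hWm : W ≠ m) (hall : ∀ i : Fin 4, i = W ∨ i = m ∨ i = a ∨ i = a') {m₃ m₄ : Fin 4 → K}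
    (h₃W : m₃ W = 1) (h₃m : m₃ m = 0) (h₄W : m₄ W = 0) (h₄m : m₄ m = 1) (t u : Fin 4) :
    (Pi.single a 1 : Fin 4 → K) t *
        ((Pi.single a 1 : Fin 4 → K) u - m₃ a * (Pi.single W 1 : Fin 4 → K) u - m₄ a * (Pi.single m 1 : Fin 4 → K) u) +
      (Pi.single a' 1 : Fin 4 → K) t *
        ((Pi.single a' 1 : Fin 4 → K) u - m₃ a' * (Pi.single W 1 : Fin 4 → K) u - m₄ a' * (Pi.single m 1 : Fin 4 → K) u) +
      m₃ t * (Pi.single W 1 : Fin 4 → K) u + m₄ t * (Pi.single m 1 : Fin 4 → K) u =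
      if t = u then 1 else 0 := by
  simp only [Pi.single_apply]
  rcases hall u with rfl | rfl | rfl | rfl <;> rcases hall t with rfl | rfl | rfl | rfl <;>
    simp [haW, ham, ha'W, ha'm, haa', hWm, haW.symm, ham.symm, ha'W.symm, ha'm.symm, haa'.symm, hWm.symm,
      h₃W, h₃m, h₄W, h₄m]

end Dual

/-! ## 2. The label: a cubic form with the two u-columns in its polar kernel lies in `(ℓ_{y₁}, ℓ_{y₂})³` -/

section Label

/-- **The identity substitution in the frame**: `x_t = Σ_i C(M_{t i}) · ℓ_i` with `ℓ_i = Σ_s C(L_{i s}) x_s`, whenever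
`M` is a left inverse of `L`. [folklore] -/
theorem X_eq_sum_C_mul_linearForm {L : Fin (2 + 2) → Fin 4 → K} {M : Fin 4 → Fin (2 + 2) → K}
    (hM : ∀ t u, ∑ i, M t i * L i u = if t = u then 1 else 0) (t : Fin 4) :
    (X t : MvPolynomial (Fin 4) K) = ∑ i, C (M t i) * ∑ s, C (L i s) * X s := by
  have h1 : (∑ i, C (M t i) * ∑ s, C (L i s) * X s : MvPolynomial (Fin 4) K) =
      ∑ s, C (∑ i, M t i * L i s) * X s := by
    simp_rw [Finset.mul_sum, ← mul_assoc, ← C_mul, map_sum, Finset.sum_mul]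
    rw [Finset.sum_comm]
  rw [h1]
  simp_rw [hM]
  rw [Finset.sum_eq_single t (fun s _ hst => by rw [if_neg (Ne.symm hst), C_0, zero_mul])
    (fun h => absurd (Finset.mem_univ t) h), if_pos rfl, C_1, one_mul]

/-- **THE LABEL LEMMA.**  Let `M` be a left inverse of the rows `L`, and let `g` be a polynomial of order `≥ 3` and total degree
`< 5 = char K` whose polar kernel `A(g)` contains the two `u`-COLUMNS of `M` (the dual vectors of `u₁, u₂`).  Then
`g ∈ (ℓ_{y₁}, ℓ_{y₂})³`: writing `x = ℓ_{y₁}(x)·col₀ + ℓ_{y₂}(x)·col₁ + u₁(x)·col_{u₁} + u₂(x)·col_{u₂}`, translation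
invariance along `A(g)` (`PhiLine.aeval_add_sum_mul_eq_aeval`, tame degree) removes the two `u`-terms, and what is left is `g`
evaluated on `(ℓ_{y₁}, ℓ_{y₂})`. [OURS] [cite: Hironaka1970AdditiveGroups, §1] [cite: CossartJannsenSaito2020, Def. 8.4] -/
theorem label_of_dual_columns [CharP K 5] {L : Fin (2 + 2) → Fin 4 → K} {M : Fin 4 → Fin (2 + 2) → K}
    (hM : ∀ t u, ∑ i, M t i * L i u = if t = u then 1 else 0) {g : MvPolynomial (Fin 4) K}
    (hg3 : g ∈ MvPolynomial.idealOfVars (Fin 4) K ^ 3) (hdeg : g.totalDegree < 5)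
    (hu1 : (fun t => M t (u1 2)) ∈ additiveSubspace g) (hu2 : (fun t => M t (u2 2)) ∈ additiveSubspace g) :
    g ∈ Ideal.span (Set.range fun i : Fin 2 =>
      (∑ s, C (L (Fin.castAdd 2 i) s) * X s : MvPolynomial (Fin 4) K)) ^ 3 := by
  classical
  set ℓ : Fin (2 + 2) → MvPolynomial (Fin 4) K := fun i => ∑ s, C (L i s) * X s with hℓ
  set I : Ideal (MvPolynomial (Fin 4) K) := Ideal.span (Set.range fun i : Fin 2 =>
    (∑ s, C (L (Fin.castAdd 2 i) s) * X s : MvPolynomial (Fin 4) K)) with hI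
  set y : Fin 4 → MvPolynomial (Fin 4) K := fun t => C (M t 0) * ℓ 0 + C (M t 1) * ℓ 1 with hy
  -- the identity substitution, split into y-part and u-part
  have hsplit : (fun t => (X t : MvPolynomial (Fin 4) K)) =
      fun t => y t + ∑ i ∈ ({u1 2, u2 2} : Finset (Fin (2 + 2))),
        algebraMap K (MvPolynomial (Fin 4) K) ((fun i : Fin (2 + 2) => fun t : Fin 4 => M t i) i t) * ℓ i := by
    funext t
    rw [X_eq_sum_C_mul_linearForm hM t, sum_frameIndex, Finset.sum_pair frameIndex_ne.2.2.2.2.2, hy]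
    simp only [MvPolynomial.algebraMap_eq, hℓ]
    ring
  have hinv : aeval y g = g := by
    have h := PhiLine.aeval_add_sum_mul_eq_aeval 5 hdeg ({u1 2, u2 2} : Finset (Fin (2 + 2)))
      (t := fun i : Fin (2 + 2) => fun t : Fin 4 => M t i) (fun i hi => by
        rcases Finset.mem_insert.mp hi with h | h
        · rw [h]; exact hu1
        · rw [Finset.mem_singleton.mp h]; exact hu2) y ℓ
    rw [← hsplit, aeval_X_left_apply] at h
    exact h.symm
  -- `aeval y` maps `𝔪₀` into `I`, hence `𝔪₀³` into `I³`
  have hmap : Ideal.map (aeval y).toRingHom (MvPolynomial.idealOfVars (Fin 4) K) ≤ I := by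
    rw [MvPolynomial.idealOfVars, Ideal.map_span, Ideal.span_le]
    rintro _ ⟨_, ⟨t, rfl⟩, rfl⟩
    rw [AlgHom.toRingHom_eq_coe, RingHom.coe_coe, aeval_X, hy]
    refine I.add_mem (I.mul_mem_left _ (Ideal.subset_span ⟨0, rfl⟩)) (I.mul_mem_left _ (Ideal.subset_span ⟨1, rfl⟩))
  rw [← hinv]
  have hmem : aeval y g ∈ Ideal.map (aeval y).toRingHom (MvPolynomial.idealOfVars (Fin 4) K ^ 3) :=
    Ideal.mem_map_of_mem _ hg3
  rw [Ideal.map_pow] at hmem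
  exact Ideal.pow_right_mono hmap 3 hmem

/-- **The residual polynomial carries the label**: if `ord₀ F = |r| + 3` and the residual cone `resForm s` lies in
`(ℓ_{y₁}, ℓ_{y₂})³` (e.g. by `label_of_dual_columns`), then `G = F / x^r ∈ (ℓ_{y₁}, ℓ_{y₂})³ ⊔ 𝔪₀⁴` — the polynomial label
condition `PhiLine.span_singleton_algebraMap_le_yIdeal_pow_sup` consumes. [OURS] [cite: CossartJannsenSaito2020, Def. 8.4] -/
theorem residual_mem_label {s : State K} (ho : ordZero s.F = ((s.r.degree + 3 : ℕ) : ℕ∞))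
    {I : Ideal (MvPolynomial (Fin 4) K)} (hform : resForm s ∈ I ^ 3) :
    s.F.divMonomial s.r ∈ I ^ 3 ⊔ Literature.AlgebraicGeometry.Resolution.originIdeal K 4 ^ (3 + 1) := by
  have hsplit : s.F.divMonomial s.r = resForm s + (s.F.divMonomial s.r - resForm s) := by ring
  rw [hsplit]
  refine Ideal.add_mem _ (Ideal.mem_sup_left hform) (Ideal.mem_sup_right ?_)
  rw [PhiLine.originIdeal_eq_idealOfVars, MvPolynomial.mem_pow_idealOfVars_iff']
  intro d hd
  rw [coeff_sub, coeff_divMonomial, coeff_resForm]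
  by_cases h3 : d.degree = 3
  · rw [NarrowApolarity.coeff_initialForm_of_degree_eq ho (by rw [map_add, h3]), sub_self]
  · have hlt : (s.r + d).degree < s.r.degree + 3 := by rw [map_add]; omega
    have hF : coeff (s.r + d) s.F = 0 := ((ordZero_eq_nat_iff _ _).mp ho).2 _ hlt
    have hin : coeff (s.r + d) (initialForm s.F) = 0 := by
      by_contra hne
      exact absurd (support_initialForm_subset s.F (MvPolynomial.mem_support_iff.mpr hne))
        (by rw [MvPolynomial.mem_support_iff, not_not]; exact hF)
    rw [hF, hin, sub_self]

end Label

/-! ## 3. STUB E: the entry frame at a Q-state -/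

section Entry

/-- Pairing an entry row with a vector: `(e_a − α e_W − β e_m) · v = v_a − α v_W − β v_m`. [folklore] -/
theorem entryRow_dot (a W m : Fin 4) (α β : K) (v : Fin 4 → K) :
    ∑ u, ((Pi.single a 1 : Fin 4 → K) u - α * (Pi.single W 1 : Fin 4 → K) u - β * (Pi.single m 1 : Fin 4 → K) u) * v u =
      v a - α * v W - β * v m := by
  have hs : ∀ (i : Fin 4), ∑ u, (Pi.single i 1 : Fin 4 → K) u * v u = v i := fun i => by
    rw [Finset.sum_eq_single i (fun u _ hu => by rw [Pi.single_eq_of_ne hu, zero_mul])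
      (fun h => absurd (Finset.mem_univ i) h), Pi.single_eq_same, one_mul]
  simp_rw [sub_mul, mul_assoc, Finset.sum_sub_distrib, ← Finset.mul_sum, hs]

/-- **A plane is spanned by its dual columns**: if `m₃, m₄ ∈ V` have `(W, m)`-coordinates `(1,0), (0,1)` and `finrank V = 2`, then
every `w ∈ V` is `w_W · m₃ + w_m · m₄`. [folklore] -/
theorem apply_eq_of_mem_plane {V : Submodule K (Fin 4 → K)} (hV : Module.finrank K V = 2) {W m : Fin 4}
    {m₃ m₄ : Fin 4 → K} (h₃ : m₃ ∈ V) (h₄ : m₄ ∈ V) (h₃W : m₃ W = 1) (h₃m : m₃ m = 0) (h₄W : m₄ W = 0) (h₄m : m₄ m = 1)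
    {w : Fin 4 → K} (hw : w ∈ V) (t : Fin 4) : w t = w W * m₃ t + w m * m₄ t := by
  set f : Fin 2 → (Fin 4 → K) := ![m₃, m₄] with hf
  have hind : LinearIndependent K f := by
    rw [hf, LinearIndependent.pair_iff]
    intro x y hxy
    have hWc := congrFun hxy W
    have hmc := congrFun hxy m
    simp only [Pi.add_apply, Pi.smul_apply, smul_eq_mul, h₃W, h₃m, h₄W, h₄m, mul_one, mul_zero, add_zero, zero_add,
      Pi.zero_apply] at hWc hmc
    exact ⟨hWc, hmc⟩
  have hle : Submodule.span K (Set.range f) ≤ V := by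
    rw [Submodule.span_le, Set.range_subset_iff]
    intro i; fin_cases i
    · exact h₃
    · exact h₄
  have heq : Submodule.span K (Set.range f) = V :=
    Submodule.eq_of_le_of_finrank_le hle (by rw [finrank_span_eq_card hind, hV, Fintype.card_fin])
  rw [← heq, Submodule.mem_span_range_iff_exists_fun] at hw
  obtain ⟨cf, hcf⟩ := hw
  have hWc := congrFun hcf W
  have hmc := congrFun hcf m
  have htc := congrFun hcf t
  simp only [Fin.sum_univ_two, Pi.add_apply, Pi.smul_apply, smul_eq_mul, hf, Matrix.cons_val_zero, Matrix.cons_val_one] at hWc hmc htc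
  rw [h₃W, h₄W, mul_one, mul_zero, add_zero] at hWc
  rw [h₃m, h₄m, mul_zero, mul_one, zero_add] at hmc
  rw [← htc, hWc, hmc]

variable [CharP K 5] [DecidableEq K]

/-- **STUB E OF THE B∞ ASSEMBLY — THE ENTRY FRAME AT A Q-STATE** (the skeleton's `stub_entryFrame` with `EntryInv`, `frameOf`,
`resIdeal` unfolded).  On TAIL-B data (isolated witnessed `Step0 5` chain, `x^{r₀} ∣ F₀`, off the floor, shade `3` and `e_G = 2`
from `k₀`), at a Q-state `k ≥ k₀` (`|r_k| = 4`) with heavy letter `W` (`r_k W = 2`) there is a linear frame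
`L : Fin (2+2) → Fin 4 → K` with left inverse `M` such that `L u₁ = e_W`, the y-rows annihilate `resVertex (c k)`, and the polygon
of `(G_k)`, `G_k = F_k / x^{r_k}`, in the frame of `𝒪 = K[x]_{(x)}` attached to `L` has `pts ≠ ∅`, `3! < δs` (a label) and `αs < 3!`
(the isolation lever).  Construction: the Q-step HITS `W` (W `bInf_pattern`), so the step direction — in `resVertex` by
`chain_direction_mem_resVertex` — is transversal to `{w_W = 0}`; `exists_dualColumns` + `entryRows_mul` give the frame and its
inverse explicitly; `PhiLine.alphaS_lt_of_isIsolated` (`u₁ = x_W`, `r_W + 3 = 5`) and `label_of_dual_columns` +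
`PhiLine.factorial_lt_deltaS_span_singleton_iff` give the polygon data. [OURS] [cite: CossartJannsenSaito2020, Def. 8.4, Lemma 12.2 (2)]
[cite: CossartPiltant2008, §4 p. 11] -/
theorem stub_entryFrame {c : ℕ → State K} {j : ℕ → Fin 4} {b : ℕ → Fin 4 → K}
    (hc : ∀ k, IsIsolated 5 (c k).F ∧ Step0 5 (c k) (c (k + 1))) (hw : FreeTail.IsWitnessedChain 5 c j b)
    (hr0 : ∀ e ∈ (c 0).F.support, (c 0).r ≤ e) (hfloor : ∀ k, ordZero (c k).F ≠ 5) {k₀ : ℕ}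
    (hshade : ∀ k, k₀ ≤ k → (c k).shade = ((3 : ℕ) : ℕ∞))
    (he : ∀ k, k₀ ≤ k → Module.finrank K (resVertex (c k)) = 2)
    {k : ℕ} (hk : k₀ ≤ k) (h4 : (c k).r.degree = 4) {W : Fin 4} (hW : (c k).r W = 2) :
    ∃ (L : Fin (2 + 2) → Fin 4 → K) (M : Fin 4 → Fin (2 + 2) → K),
      (∀ t u, ∑ i, M t i * L i u = if t = u then 1 else 0) ∧ L (u1 2) = Pi.single W 1 ∧
      (∀ i, i ≠ u1 2 → i ≠ u2 2 → ∀ w ∈ resVertex (c k), ∑ t, L i t * w t = 0) ∧ (c k).r W = 2 ∧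
      (pts (fun i => algebraMap (MvPolynomial (Fin 4) K) (OriginLocalization K 4) (∑ t, C (L i t) * X t))
        (Ideal.span {algebraMap (MvPolynomial (Fin 4) K) (OriginLocalization K 4)
          ((c k).F.divMonomial (c k).r)}) 3).Nonempty ∧
      Nat.factorial 3 < deltaS (fun i => algebraMap (MvPolynomial (Fin 4) K) (OriginLocalization K 4)
        (∑ t, C (L i t) * X t)) (Ideal.span {algebraMap (MvPolynomial (Fin 4) K) (OriginLocalization K 4)
          ((c k).F.divMonomial (c k).r)}) 3 ∧
      alphaS (fun i => algebraMap (MvPolynomial (Fin 4) K) (OriginLocalization K 4) (∑ t, C (L i t) * X t))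
        (Ideal.span {algebraMap (MvPolynomial (Fin 4) K) (OriginLocalization K 4)
          ((c k).F.divMonomial (c k).r)}) 3 < Nat.factorial 3 := by
  haveI : Fact (Nat.Prime 5) := ⟨by norm_num⟩
  obtain ⟨hF, -, -, -⟩ := bInf_factorisation hc hw hr0 hfloor hshade hk
  obtain ⟨hord, -, -, -, -⟩ := three_weights_laws hc hw hr0 hfloor hshade
  have ho := hord k hk
  -- the step direction is in the polar kernel and is transversal to `{w_W = 0}`
  have hdir : direction (j k) (b k) ∈ resVertex (c k) := chain_direction_mem_resVertex 5 hc hw hr0 hfloor hshade hk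
  have hdirW : direction (j k) (b k) W ≠ 0 := by
    have hhit := ((bInf_pattern hc hw hr0 hfloor hshade hk hW).2.1 h4).1
    by_cases hj : j k = W
    · rw [← hj, direction_apply_self]; exact one_ne_zero
    · unfold direction
      rw [Function.update_of_ne (Ne.symm hj)]
      exact hhit.resolve_left hj
  -- dual columns and the two other letters
  obtain ⟨m, m₃, m₄, hmW, hm₃V, hm₄V, h₃W, h₃m, h₄W, h₄m⟩ := exists_dualColumns (he k hk) hdir hdirW
  obtain ⟨a, a', haW, ham, ha'W, ha'm, haa', hall⟩ := exists_two_other_letters (Ne.symm hmW)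
  -- the frame and its inverse
  set rowA : Fin 4 → K := fun u =>
    (Pi.single a 1 : Fin 4 → K) u - m₃ a * (Pi.single W 1 : Fin 4 → K) u - m₄ a * (Pi.single m 1 : Fin 4 → K) u with hrowA
  set rowA' : Fin 4 → K := fun u =>
    (Pi.single a' 1 : Fin 4 → K) u - m₃ a' * (Pi.single W 1 : Fin 4 → K) u - m₄ a' * (Pi.single m 1 : Fin 4 → K) u with hrowA'
  set L : Fin (2 + 2) → Fin 4 → K := fun i =>
    if i = u1 2 then Pi.single W 1 else if i = u2 2 then Pi.single m 1 else if i = 0 then rowA else rowA' with hL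
  set M : Fin 4 → Fin (2 + 2) → K := fun t i =>
    if i = u1 2 then m₃ t else if i = u2 2 then m₄ t else if i = 0 then (Pi.single a 1 : Fin 4 → K) t
      else (Pi.single a' 1 : Fin 4 → K) t with hM
  obtain ⟨h0u1, h0u2, h1u1, h1u2, h01, hu12⟩ := frameIndex_ne
  have hLu1 : L (u1 2) = Pi.single W 1 := by rw [hL]; exact if_pos rfl
  have hLu2 : L (u2 2) = Pi.single m 1 := by rw [hL]; simp only [if_neg (Ne.symm hu12), if_pos]
  have hL0 : L 0 = rowA := by rw [hL]; simp only [if_neg h0u1, if_neg h0u2, if_pos]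
  have hL1 : L 1 = rowA' := by rw [hL]; simp only [if_neg h1u1, if_neg h1u2, if_neg (Ne.symm h01)]
  have hMu1 : ∀ t, M t (u1 2) = m₃ t := fun t => by rw [hM]; exact if_pos rfl
  have hMu2 : ∀ t, M t (u2 2) = m₄ t := fun t => by rw [hM]; simp only [if_neg (Ne.symm hu12), if_pos]
  have hM0 : ∀ t, M t 0 = (Pi.single a 1 : Fin 4 → K) t := fun t => by rw [hM]; simp only [if_neg h0u1, if_neg h0u2, if_pos]
  have hM1 : ∀ t, M t 1 = (Pi.single a' 1 : Fin 4 → K) t := fun t => by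
    rw [hM]; simp only [if_neg h1u1, if_neg h1u2, if_neg (Ne.symm h01)]
  have hinv : ∀ t u, ∑ i, M t i * L i u = if t = u then 1 else 0 := by
    intro t u
    rw [sum_frameIndex, hM0, hM1, hMu1, hMu2, hL0, hL1, hLu1, hLu2]
    exact entryRows_mul haW ham ha'W ha'm haa' (Ne.symm hmW) hall h₃W h₃m h₄W h₄m t u
  -- the y-rows annihilate the polar kernel
  have hy : ∀ i, i ≠ u1 2 → i ≠ u2 2 → ∀ w ∈ resVertex (c k), ∑ t, L i t * w t = 0 := by
    intro i hi1 hi2 w hwV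
    have hdec := apply_eq_of_mem_plane (he k hk) hm₃V hm₄V h₃W h₃m h₄W h₄m hwV
    rcases frameIndex_cases i with hi | hi | hi | hi
    · rw [hi, hL0, hrowA, entryRow_dot, hdec a, hdec W, hdec m, h₃W, h₃m, h₄W, h₄m]; ring
    · rw [hi, hL1, hrowA', entryRow_dot, hdec a', hdec W, hdec m, h₃W, h₃m, h₄W, h₄m]; ring
    · exact absurd hi hi1
    · exact absurd hi hi2
  -- polygon data in `𝒪`
  have hgen := PhiLine.span_range_linearFrame_eq_maximalIdeal L M hinv
  have hdim := PhiLine.ringKrullDim_originLocalization_two_add_two (K := K)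
  have hu1' : (fun i => algebraMap (MvPolynomial (Fin 4) K) (OriginLocalization K 4) (∑ t, C (L i t) * X t)) (u1 2) =
      algebraMap (MvPolynomial (Fin 4) K) (OriginLocalization K 4) (X W) := by
    show algebraMap _ _ (∑ t, C (L (u1 2) t) * X t) = _
    rw [hLu1, PhiLine.sum_C_single_mul_X]
  obtain ⟨hne, hα⟩ := PhiLine.alphaS_lt_of_isIsolated (d := 3) hF (hc k).1 (h := W) (by omega) _ hgen hu1'
  refine ⟨L, M, hinv, hLu1, hy, hW, hne, ?_, hα⟩
  -- the label: `G ∈ (ℓ_y)³ ⊔ 𝔪₀⁴`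
  have hhom : (resForm (c k)).IsHomogeneous 3 := by
    have h := resForm_isHomogeneous ho
    rwa [show (c k).r.degree + 3 - (c k).r.degree = 3 by omega] at h
  have hg3 : resForm (c k) ∈ MvPolynomial.idealOfVars (Fin 4) K ^ 3 := by
    rw [MvPolynomial.mem_pow_idealOfVars_iff']
    intro x hx
    by_contra hne'
    have := hhom hne'
    rw [weight_one_eq_degree] at this
    omega
  have hcol1 : (fun t => M t (u1 2)) ∈ additiveSubspace (resForm (c k)) := by
    rw [show (fun t => M t (u1 2)) = m₃ from funext hMu1]; exact hm₃V
  have hcol2 : (fun t => M t (u2 2)) ∈ additiveSubspace (resForm (c k)) := by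
    rw [show (fun t => M t (u2 2)) = m₄ from funext hMu2]; exact hm₄V
  have hlabel := residual_mem_label ho
    (label_of_dual_columns hinv hg3 (lt_of_le_of_lt hhom.totalDegree_le (by norm_num)) hcol1 hcol2)
  exact (PhiLine.factorial_lt_deltaS_span_singleton_iff _ 3 hgen hdim hne).mpr
    (PhiLine.algebraMap_mem_yIdeal_pow_sup L hlabel)

end Entry

end ResCone

end Summit.ResolutionOfSingularities.ResolutionOfSingularities.Theorems.PIDim4

end
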